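import Mathlib
import Summits.Ventures.PercRepro.TriangleCapRegularCellSet

/-!
# PercRepro — THE FIRST GAP OF THE REGULAR CELL, FOR EVERY `ℓ`: `bottom` THEN `bottom + ℓ − 1` (p3, gen 54; part 290)

In the regular cell `t = ℓ D` (`2 ≤ ℓ ≤ D`) the band value is `bottomReg ℓ D + ½ Σ_{rows} k (ℓ − k)` with
`bottomReg ℓ D = ℓ D (ℓ − 1)(D − 1) / 2` (the value of `K_{ℓ,D}`; part 289).  A single partial row is impossible
(`Σ k = ℓ D ≡ 0 (mod ℓ)` while one partial row leaves a residue `1 ≤ k₀ ≤ ℓ − 1`: `partial_count_ne_one`), and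
each partial row costs `k (ℓ − k) ≥ ℓ − 1`; so the row excess is `0` or at least `2 (ℓ − 1)`
(`row_excess_zero_or_ge`), and the rows `(1, ℓ − 1, ℓ, …, ℓ)` attain exactly `2 (ℓ − 1)`.  THEOREM
(`regular_cell_first_gap`): every band value of the regular cell is `bottomReg` or at least `bottomReg + ℓ − 1`,
and both `bottomReg` and `bottomReg + ℓ − 1` are attained — **THE FIRST GAP OF THE REGULAR CELL IS EXACTLY
`[bottomReg + 1, bottomReg + ℓ − 2]`** (empty at `ℓ = 2`, the single value `bottom + 1` at `ℓ = 3` (part 281), two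
values at `ℓ = 4` (the census of §10dm), …).  Axioms: standard.
-/

namespace PercRepro

namespace TriangleCap

namespace C047

open Finset

/-- The bottom of the regular cell: `ℓ D (ℓ − 1)(D − 1) / 2`, the value of `K_{ℓ,D}`. -/
def bottomReg (ℓ D : ℕ) : ℕ := ℓ * D * (ℓ - 1) * (D - 1) / 2

/-- `2 bottomReg ℓ D + 2 t (D − 1) = t (t − 1) + ℓ D (D − ℓ)` for `t = ℓ D`, `1 ≤ ℓ ≤ D`. -/
theorem two_mul_bottomReg (ℓ D : ℕ) (hℓ : 1 ≤ ℓ) (hℓD : ℓ ≤ D) :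
    2 * bottomReg ℓ D + 2 * (ℓ * D * (D - 1)) = ℓ * D * (ℓ * D - 1) + ℓ * D * (D - ℓ) := by
  unfold bottomReg
  have hev : Even (ℓ * D * (ℓ - 1) * (D - 1)) := by
    rcases Nat.even_or_odd ℓ with h | h
    · exact (h.mul_right D).mul_right (ℓ - 1) |>.mul_right (D - 1)
    · have : Even (ℓ - 1) := by
        obtain ⟨a, ha⟩ := h
        exact ⟨a, by omega⟩
      exact (this.mul_left (ℓ * D)).mul_right (D - 1)
  rw [Nat.two_mul_div_two_of_even hev]
  obtain ⟨ℓ', rfl⟩ : ∃ ℓ', ℓ = ℓ' + 1 := ⟨ℓ - 1, by omega⟩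
  obtain ⟨m, rfl⟩ : ∃ m, D = ℓ' + 1 + m := ⟨D - (ℓ' + 1), by omega⟩
  have e1 : ℓ' + 1 - 1 = ℓ' := by omega
  have e2 : ℓ' + 1 + m - 1 = ℓ' + m := by omega
  have e3 : ℓ' + 1 + m - (ℓ' + 1) = m := by omega
  have e4 : (ℓ' + 1) * (ℓ' + 1 + m) - 1 = ℓ' * (ℓ' + 1 + m) + ℓ' + m := by
    have : (ℓ' + 1) * (ℓ' + 1 + m) = ℓ' * (ℓ' + 1 + m) + ℓ' + m + 1 := by ring
    omega
  rw [e1, e2, e3, e4]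
  ring

/-- A partial row costs at least `ℓ − 1`: `ℓ − 1 ≤ k (ℓ − k)` for `1 ≤ k < ℓ`. -/
theorem pred_le_mul_sub (k ℓ : ℕ) (h1 : 1 ≤ k) (h2 : k < ℓ) : ℓ - 1 ≤ k * (ℓ - k) := by
  obtain ⟨k', rfl⟩ : ∃ k', k = k' + 1 := ⟨k - 1, by omega⟩
  obtain ⟨m, rfl⟩ : ∃ m, ℓ = k' + 1 + 1 + m := ⟨ℓ - k' - 2, by omega⟩
  have e1 : k' + 1 + 1 + m - (k' + 1) = m + 1 := by omega
  have e2 : k' + 1 + 1 + m - 1 = k' + 1 + m := by omega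
  rw [e1, e2]
  nlinarith

/-- The number of partial rows of a sequence: `#{m < N : k m < ℓ}`. -/
def partialCount (ℓ : ℕ) (k : ℕ → ℕ) (N : ℕ) : ℕ := ((range N).filter (fun m => k m < ℓ)).card

/-- The row sum through the partial rows: `Σ k = ℓ · #{full} + Σ_{partial} k`. -/
theorem sum_eq_mul_full_add_partial (ℓ : ℕ) (k : ℕ → ℕ) (N : ℕ) (hkℓ : ∀ m, m < N → k m ≤ ℓ) :
    ∑ m ∈ range N, k m =
      ℓ * ((range N).filter (fun m => ¬ k m < ℓ)).card + ∑ m ∈ (range N).filter (fun m => k m < ℓ), k m := by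
  rw [← sum_filter_add_sum_filter_not (range N) (fun m => k m < ℓ), add_comm]
  congr 1
  rw [card_eq_sum_ones, mul_sum]
  apply sum_congr rfl
  intro m hm
  rw [mem_filter] at hm
  have := hkℓ m (mem_range.mp hm.1)
  have : k m = ℓ := by omega
  omega

/-- **ONE PARTIAL ROW IS IMPOSSIBLE:** with `Σ_{m < N} k m = ℓ D` and every `k m ≤ ℓ`, the number of partial rows
is not `1` (`1 ≤ ℓ`). -/
theorem partial_count_ne_one (ℓ D : ℕ) (k : ℕ → ℕ) (N : ℕ) (hℓ : 1 ≤ ℓ) (hk : ∀ m, m < N → 1 ≤ k m)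
    (hkℓ : ∀ m, m < N → k m ≤ ℓ) (hsum : ∑ m ∈ range N, k m = ℓ * D) : partialCount ℓ k N ≠ 1 := by
  intro h1
  unfold partialCount at h1
  obtain ⟨m₀, hm₀⟩ := card_eq_one.mp h1
  have hsplit := sum_eq_mul_full_add_partial ℓ k N hkℓ
  rw [hm₀, sum_singleton] at hsplit
  have hm₀mem : m₀ ∈ (range N).filter (fun m => k m < ℓ) := by
    rw [hm₀]
    exact mem_singleton_self m₀
  rw [mem_filter, mem_range] at hm₀mem
  have hk0 := hk m₀ hm₀mem.1
  -- `ℓ D = ℓ F + k₀` with `1 ≤ k₀ < ℓ`: `ℓ ∣ k₀`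
  set F := ((range N).filter (fun m => ¬ k m < ℓ)).card with hF
  have hdvd : ℓ ∣ k m₀ := by
    have h1 : ℓ * F ≤ ℓ * D := by omega
    have h2 : F ≤ D := Nat.le_of_mul_le_mul_left h1 (by omega)
    have : k m₀ = ℓ * (D - F) := by
      rw [Nat.mul_sub]
      omega
    exact ⟨D - F, this⟩
  have := Nat.le_of_dvd (by omega) hdvd
  omega

/-- **THE ROW EXCESS IS `0` OR AT LEAST `2 (ℓ − 1)`:** with `Σ_{m < N} k m = ℓ D`, `1 ≤ k m ≤ ℓ`,
`Σ_{m < N} k m (ℓ − k m) = 0 ∨ 2 (ℓ − 1) ≤ Σ_{m < N} k m (ℓ − k m)`. -/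
theorem row_excess_zero_or_ge (ℓ D : ℕ) (k : ℕ → ℕ) (N : ℕ) (hℓ : 1 ≤ ℓ) (hk : ∀ m, m < N → 1 ≤ k m)
    (hkℓ : ∀ m, m < N → k m ≤ ℓ) (hsum : ∑ m ∈ range N, k m = ℓ * D) :
    ∑ m ∈ range N, k m * (ℓ - k m) = 0 ∨ 2 * (ℓ - 1) ≤ ∑ m ∈ range N, k m * (ℓ - k m) := by
  have hne := partial_count_ne_one ℓ D k N hℓ hk hkℓ hsum
  unfold partialCount at hne
  -- the excess lives on the partial rows
  have hex : ∑ m ∈ range N, k m * (ℓ - k m) = ∑ m ∈ (range N).filter (fun m => k m < ℓ), k m * (ℓ - k m) := by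
    rw [sum_filter]
    apply sum_congr rfl
    intro m hm
    have := hkℓ m (mem_range.mp hm)
    split_ifs with h
    · rfl
    · have : k m = ℓ := by omega
      rw [this, Nat.sub_self, mul_zero]
  rcases Nat.eq_zero_or_pos ((range N).filter (fun m => k m < ℓ)).card with h0 | hpos
  · left
    rw [hex, card_eq_zero.mp h0, sum_empty]
  · right
    have h2 : 2 ≤ ((range N).filter (fun m => k m < ℓ)).card := by omega
    rw [hex]
    calc 2 * (ℓ - 1) ≤ ((range N).filter (fun m => k m < ℓ)).card * (ℓ - 1) := Nat.mul_le_mul_right _ h2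
      _ = ∑ _m ∈ (range N).filter (fun m => k m < ℓ), (ℓ - 1) := by rw [sum_const, smul_eq_mul]
      _ ≤ ∑ m ∈ (range N).filter (fun m => k m < ℓ), k m * (ℓ - k m) := by
        apply sum_le_sum
        intro m hm
        rw [mem_filter, mem_range] at hm
        exact pred_le_mul_sub (k m) ℓ (hk m hm.1) hm.2

/-- The rows `(1, ℓ − 1, ℓ, …, ℓ)`: `D + 1` rows summing to `ℓ D` with excess `2 (ℓ − 1)`. -/
def rowsGap (ℓ m : ℕ) : ℕ := if m = 0 then 1 else if m = 1 then ℓ - 1 else ℓ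

/-- The row sum of `rowsGap`: `Σ_{m < D + 1} rowsGap ℓ m = ℓ D` (`1 ≤ D`, `2 ≤ ℓ`). -/
theorem sum_rowsGap (ℓ D : ℕ) (hℓ : 2 ≤ ℓ) (hD : 1 ≤ D) : ∑ m ∈ range (D + 1), rowsGap ℓ m = ℓ * D := by
  obtain ⟨D', rfl⟩ : ∃ D', D = D' + 1 := ⟨D - 1, by omega⟩
  rw [sum_range_succ', sum_range_succ']
  have h : ∀ m ∈ range D', rowsGap ℓ (m + 1 + 1) = ℓ := fun m _ => by
    unfold rowsGap
    rw [if_neg (by omega), if_neg (by omega)]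
  rw [sum_congr rfl h, sum_const, card_range, smul_eq_mul]
  unfold rowsGap
  simp only [if_true, if_false, zero_add, one_ne_zero]
  have : D' * ℓ + (ℓ - 1) + 1 = ℓ * (D' + 1) := by
    obtain ⟨ℓ', rfl⟩ : ∃ ℓ', ℓ = ℓ' + 1 := ⟨ℓ - 1, by omega⟩
    rw [Nat.add_sub_cancel]
    ring
  omega

/-- The excess of `rowsGap`: `Σ_{m < D + 1} rowsGap ℓ m (ℓ − rowsGap ℓ m) = 2 (ℓ − 1)`. -/
theorem excess_rowsGap (ℓ D : ℕ) (hℓ : 2 ≤ ℓ) (hD : 1 ≤ D) :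
    ∑ m ∈ range (D + 1), rowsGap ℓ m * (ℓ - rowsGap ℓ m) = 2 * (ℓ - 1) := by
  obtain ⟨D', rfl⟩ : ∃ D', D = D' + 1 := ⟨D - 1, by omega⟩
  rw [sum_range_succ', sum_range_succ']
  have h : ∀ m ∈ range D', rowsGap ℓ (m + 1 + 1) * (ℓ - rowsGap ℓ (m + 1 + 1)) = 0 := fun m _ => by
    unfold rowsGap
    rw [if_neg (by omega), if_neg (by omega), Nat.sub_self, mul_zero]
  rw [sum_congr rfl h, sum_const_zero]
  unfold rowsGap
  simp only [if_true, if_false, zero_add, one_ne_zero]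
  have : ℓ - (ℓ - 1) = 1 := by omega
  rw [this]
  omega

/-- **THE FIRST GAP OF THE REGULAR CELL:** for `2 ≤ ℓ ≤ D`, `t = ℓ D`, `2 t ≤ s`: every band value `j` of a
triangle-free graph on `ℓ + 1 + (s − t)` vertices with `s` edges, a vertex of degree `s − t` and every off-degree
`≤ D` is `bottomReg ℓ D` or at least `bottomReg ℓ D + (ℓ − 1)`, and both values are attained. -/
theorem regular_cell_first_gap (s t ℓ D : ℕ) (hℓ : 2 ≤ ℓ) (hℓD : ℓ ≤ D) (ht : t = ℓ * D) (hs : 2 * t ≤ s) :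
    (∀ j, (∃ (H : SimpleGraph (Fin (ℓ + 1 + (s - t)))) (_ : DecidableRel H.Adj), H.CliqueFree 3 ∧
        H.edgeFinset.card = s ∧ ∃ w, deg H w + t = s ∧ (∀ v, offDeg H w v ≤ D) ∧
          ∑ v, deg H v * deg H v + 2 * (t * (s - t - 1)) + 2 * j = s * (s + 1)) →
      j = bottomReg ℓ D ∨ bottomReg ℓ D + (ℓ - 1) ≤ j) ∧
    (∃ (H : SimpleGraph (Fin (ℓ + 1 + (s - t)))) (_ : DecidableRel H.Adj), H.CliqueFree 3 ∧
        H.edgeFinset.card = s ∧ ∃ w, deg H w + t = s ∧ (∀ v, offDeg H w v ≤ D) ∧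
          ∑ v, deg H v * deg H v + 2 * (t * (s - t - 1)) + 2 * bottomReg ℓ D = s * (s + 1)) ∧
    (∃ (H : SimpleGraph (Fin (ℓ + 1 + (s - t)))) (_ : DecidableRel H.Adj), H.CliqueFree 3 ∧
        H.edgeFinset.card = s ∧ ∃ w, deg H w + t = s ∧ (∀ v, offDeg H w v ≤ D) ∧
          ∑ v, deg H v * deg H v + 2 * (t * (s - t - 1)) + 2 * (bottomReg ℓ D + (ℓ - 1)) = s * (s + 1)) := by
  subst ht
  have hb := two_mul_bottomReg ℓ D (by omega) hℓD
  refine ⟨fun j hj => ?_, ?_, ?_⟩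
  · obtain ⟨N, k, hk, hsum, hid⟩ := (regular_cell_iff s (ℓ * D) ℓ D j (by omega) hℓD rfl hs).mp hj
    rcases row_excess_zero_or_ge ℓ D k N (by omega) (fun m hm => (hk m hm).1) (fun m hm => (hk m hm).2) hsum
      with h0 | hge
    · left
      omega
    · right
      omega
  · -- the bottom: `D` full rows
    apply (regular_cell_iff s (ℓ * D) ℓ D (bottomReg ℓ D) (by omega) hℓD rfl hs).mpr
    refine ⟨D, fun _ => ℓ, fun m _ => ⟨show 1 ≤ ℓ by omega, le_rfl⟩,
      by rw [sum_const, card_range, smul_eq_mul, mul_comm], ?_⟩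
    rw [sum_eq_zero (fun m _ => by rw [Nat.sub_self, mul_zero]), add_zero]
    omega
  · -- the first value above the gap: the rows `(1, ℓ − 1, ℓ, …, ℓ)`
    apply (regular_cell_iff s (ℓ * D) ℓ D (bottomReg ℓ D + (ℓ - 1)) (by omega) hℓD rfl hs).mpr
    refine ⟨D + 1, rowsGap ℓ, fun m _ => ?_, sum_rowsGap ℓ D hℓ (by omega), ?_⟩
    · unfold rowsGap
      split_ifs <;> omega
    · rw [excess_rowsGap ℓ D hℓ (by omega)]
      omega

end C047

end TriangleCap

end PercRepro
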